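import Literature.NumberTheory.Automorphic.UnitaryGroupFiniteCovolume
import Literature.NumberTheory.Automorphic.HermitianOrbitCountSiegelIntegrable
import HarnessLib

/-!
# The automorphic measure of `U(H)(L⁺)\U(H)(𝔸_{L⁺})` exists for every non-degenerate hermitian `H`
# (Borel–Harish-Chandra finiteness for unitary groups, unconditional)

Topic `NumberTheory/Automorphic`; namespace `Literature.NumberTheory.Automorphic.UnitaryGroup`.
Proof file (theorems only). For a CM field `L` with complex conjugation `c`, any `N` and any matrix
`H ∈ M_N(L)` with `ᵗ(c H) = H` and `det H ≠ 0`, the automorphic quotient of the adelic group datum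
`UnitaryGroup.cmDatum L N H` — the coset space `U(H)(𝔸_{L⁺}) ⧸ U(H)(L⁺)` — carries an automorphic
measure (`AdelicGroupData.IsAutomorphicMeasure`: finite, positive on non-empty open sets, inner
regular, `U(H)(𝔸)`-invariant):

* `exists_isAutomorphicMeasure_cmDatum_of_isHermitian` — **`∃ μ', (cmDatum L N H).IsAutomorphicMeasure μ'`**.

This is the assembly of the orbit-count unfolding route (cell hodgecm-mathlib, line
`F0_T1InnerFormTraceIdentity`, stub S3): the descent `exists_isAutomorphicMeasure_cmDatum_of_orbitCount`
(`UnitaryGroupFiniteCovolume`: unfolding against `GL_N(L)\GL_N(𝔸_L)`, lattice ⇒ unimodular, the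
covering-set constructor) fed with the Siegel-set integrability of the hermitian lattice-point count
`lintegral_ncard_hermitianOrbitSet_siegelSet_lt_top` (`HermitianOrbitCountSiegelIntegrable`: box count,
cone inequality, explicit modulus, dyadic summation). The anisotropic case was already in the tree by
compactness (`exists_isAutomorphicMeasure_cmDatum`, Godement's criterion); the present theorem needs no
anisotropy. Uniqueness up to a positive scalar is `isAutomorphicMeasure_unique_smul_cmDatum`
(`AdelicUnitaryGroupMeasureUniqueness`). Borel (1963), §5, Thm. 5.8; Borel–Harish-Chandra (1962),
Thm. 7.8 / 9.4 (`G` reductive, `X_ℚ(G⁰) = 1` ⇒ finite volume); Platonov–Rapinchuk (1994), Thm. 4.17.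

## References

* A. Borel, *Some finiteness properties of adele groups over number fields*, Publ. Math. IHÉS 16
  (1963), §5, Thm. 5.8 [Borel1963].
* V. Platonov, A. Rapinchuk, *Algebraic Groups and Number Theory* (1994), Thm. 4.17
  [PlatonovRapinchuk1994].
-/

noncomputable section

open MeasureTheory Measure NumberField IsDedekindDomain Matrix Set
open scoped MatrixGroups ENNReal NNReal

namespace Literature.NumberTheory.Automorphic

namespace UnitaryGroup

variable (L : Type) [Field L] [NumberField L] [IsCMField L] (N : ℕ) (H : Matrix (Fin N) (Fin N) L)

/-- **Borel–Harish-Chandra finiteness for unitary groups (unconditional).** For a CM field `L`, any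
`N`, and a hermitian matrix `H ∈ M_N(L)` (`ᵗ(c H) = H`) with `det H ≠ 0`, the automorphic quotient
`U(H)(𝔸_{L⁺}) ⧸ U(H)(L⁺)` of `UnitaryGroup.cmDatum L N H` carries an automorphic measure: finite,
positive on non-empty open sets, inner regular and `U(H)(𝔸_{L⁺})`-invariant
(`exists_isAutomorphicMeasure_cmDatum_of_orbitCount` with the hermitian orbit count
`lintegral_ncard_hermitianOrbitSet_siegelSet_lt_top`). Borel (1963), Thm. 5.8 (finite invariant volume
of `G_k\G_A` for reductive `G` without rational characters), here for `G = U(H)` over `L⁺`.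
[cite: Borel1963, Thm. 5.8] -/
theorem exists_isAutomorphicMeasure_cmDatum_of_isHermitian (hH : (H.map (cmConjRingHom L))ᵀ = H)
    (hdet : H.det ≠ 0) :
    ∃ μ' : Measure (cmDatum L N H).automorphicQuotient, (cmDatum L N H).IsAutomorphicMeasure μ' :=
  exists_isAutomorphicMeasure_cmDatum_of_orbitCount hH hdet
    fun _ _ μ _ _ hB _ _ _ ht hΩc hΩB hZc hZ =>
      lintegral_ncard_hermitianOrbitSet_siegelSet_lt_top L N μ hB hΩc hΩB ht hZc hZ

/-- The same with the non-degeneracy phrased as `IsUnit H.det` (e.g. for `H ∈ GL_N(L)`).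
[cite: Borel1963, Thm. 5.8] -/
theorem exists_isAutomorphicMeasure_cmDatum_of_isUnit_det (hH : (H.map (cmConjRingHom L))ᵀ = H)
    (hdet : IsUnit H.det) :
    ∃ μ' : Measure (cmDatum L N H).automorphicQuotient, (cmDatum L N H).IsAutomorphicMeasure μ' :=
  exists_isAutomorphicMeasure_cmDatum_of_isHermitian L N H hH hdet.ne_zero

/-- **For a rational unitary-group element's Gram matrix `H ∈ GL_N(L)`** (the shape in which the
Shimura-variety and theta-dictionary files carry their hermitian forms): an automorphic measure on
`U(H)(𝔸_{L⁺}) ⧸ U(H)(L⁺)` exists whenever `ᵗ(c H) = H`. [cite: Borel1963, Thm. 5.8] -/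
theorem exists_isAutomorphicMeasure_cmDatum_generalLinearGroup (H : GL (Fin N) L)
    (hH : ((H : Matrix (Fin N) (Fin N) L).map (cmConjRingHom L))ᵀ = H) :
    ∃ μ' : Measure (cmDatum L N (H : Matrix (Fin N) (Fin N) L)).automorphicQuotient,
      (cmDatum L N (H : Matrix (Fin N) (Fin N) L)).IsAutomorphicMeasure μ' :=
  exists_isAutomorphicMeasure_cmDatum_of_isUnit_det L N (H : Matrix (Fin N) (Fin N) L) hH
    (Matrix.isUnits_det_units H)

end UnitaryGroup

end Literature.NumberTheory.Automorphic
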